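import Mathlib.Combinatorics.SimpleGraph.Finite
import Mathlib.Algebra.BigOperators.Group.Finset.Basic
import Mathlib.Algebra.Order.BigOperators.Group.Finset
import HarnessLib

/-!
# Non-backtracking walk counts (Alon–Hoory–Linial, proof of the irregular Moore bound), I

Support for the proof of `Literature.Combinatorics.SimpleGraph.alonHooryLinial_mooreBound`
(`MooreBound.lean`; Theorem 1 of [AlonHooryLinial2002]): the two bookkeeping objects of the
proof, for a finite simple graph `H`,

* `nbCount H k u v` — the number `N_{uv,k}` of non-backtracking ("non-returning", p. 55) walks
  that start with the step `u → v` and make `k` further steps, defined by the obvious recursion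
  over the next step `v → w`, `w ∈ N(v) ∖ {u}`;
* `branch H k u v` — the finite set of endpoints of those walks (recursive `biUnion`),

with their unfolding lemmas, positivity of `nbCount` on darts when all non-isolated vertices
have degree `≥ 2`, and the dart-reversal reindexing identity `sum_neighborFinset_comm`.
The tree structure of balls (`MooreBoundBalls.lean`), the walk-count inequality
(`MooreBoundCount.lean`) and the theorem itself (`MooreBoundProofs.lean`) build on this file.
Design: darts are handled as pairs `v`, `u ∈ H.neighborFinset v` (double `Finset.sum`) rather
than `SimpleGraph.Dart`, which keeps the recursion and the sums elementary.

## References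

* N. Alon, S. Hoory, N. Linial, The Moore bound for irregular graphs, *Graphs Combin.* 18
  (2002) 53–57 [AlonHooryLinial2002].
-/

namespace Literature.Combinatorics.SimpleGraph.AlonHooryLinial

open _root_.SimpleGraph Finset

section Counting

variable {V : Type*} [Fintype V] [DecidableEq V] (H : _root_.SimpleGraph V)
  [DecidableRel H.Adj]

/-- `nbCount H k u v` is the number of non-backtracking ("non-returning") walks of `H` that start
with the step `u → v` and make `k` further steps, i.e. `N_{uv,k}` of Alon–Hoory–Linial; defined by
the recursion over the first further step `v → w`, `w ∈ N(v) \ {u}`.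
[cite: AlonHooryLinial2002, §proof of Thm 1, p. 55] -/
def nbCount : ℕ → V → V → ℕ
  | 0, _, _ => 1
  | k + 1, u, v => ∑ w ∈ (H.neighborFinset v).erase u, nbCount k v w

/-- `branch H k u v` is the set of endpoints of the non-backtracking walks counted by
`nbCount H k u v` (the vertices at depth `k` below `v` in the branch of the breadth-first tree
entered through the step `u → v`). [cite: AlonHooryLinial2002, §proof of Thm 1, p. 56] -/
def branch : ℕ → V → V → Finset V
  | 0, _, v => {v}
  | k + 1, u, v => ((H.neighborFinset v).erase u).biUnion fun w => branch k v w

/-- Unfolding of `nbCount` at `0`. [cite: AlonHooryLinial2002, §proof of Thm 1] -/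
@[simp] theorem nbCount_zero (u v : V) : nbCount H 0 u v = 1 := rfl

/-- Unfolding of `nbCount` at a successor. [cite: AlonHooryLinial2002, §proof of Thm 1] -/
theorem nbCount_succ (k : ℕ) (u v : V) :
    nbCount H (k + 1) u v = ∑ w ∈ (H.neighborFinset v).erase u, nbCount H k v w := rfl

/-- Unfolding of `branch` at `0`. [cite: AlonHooryLinial2002, §proof of Thm 1] -/
@[simp] theorem branch_zero (u v : V) : branch H 0 u v = {v} := rfl

/-- Unfolding of `branch` at a successor. [cite: AlonHooryLinial2002, §proof of Thm 1] -/
theorem branch_succ (k : ℕ) (u v : V) :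
    branch H (k + 1) u v = ((H.neighborFinset v).erase u).biUnion fun w => branch H k v w := rfl

variable {H}

/-- In a graph whose non-isolated vertices all have degree `≥ 2`, every step `u → v` has at least
one non-backtracking continuation of every length. [cite: AlonHooryLinial2002, §proof of Thm 1] -/
theorem nbCount_pos (h2 : ∀ v, 0 < H.degree v → 2 ≤ H.degree v) :
    ∀ (k : ℕ) {u v : V}, H.Adj u v → 0 < nbCount H k u v := by
  intro k
  induction k with
  | zero => intro u v _; simp
  | succ k ih =>
    intro u v huv
    rw [nbCount_succ]
    have hcard : ((H.neighborFinset v).erase u).card = H.degree v - 1 := by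
      rw [card_erase_of_mem ((mem_neighborFinset ..).2 huv.symm), card_neighborFinset_eq_degree]
    have hne : ((H.neighborFinset v).erase u).Nonempty := by
      rw [← card_pos, hcard]
      have := h2 v huv.symm.degree_pos_left
      omega
    exact sum_pos (fun w hw => ih ((mem_neighborFinset ..).1 (mem_of_mem_erase hw))) hne

omit [DecidableEq V] in
/-- Reindexing a sum over the directed edges ("darts") `u → v` of a finite graph by reversing
every dart. [folklore] -/
theorem sum_neighborFinset_comm {M : Type*} [AddCommMonoid M] (f : V → V → M) :
    ∑ v, ∑ u ∈ H.neighborFinset v, f u v = ∑ v, ∑ u ∈ H.neighborFinset v, f v u := by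
  have h1 : ∀ g : V → V → M,
      ∑ v, ∑ u ∈ H.neighborFinset v, g u v = ∑ v, ∑ u, if H.Adj u v then g u v else 0 := by
    intro g
    refine sum_congr rfl fun v _ => ?_
    rw [neighborFinset_eq_filter, sum_filter]
    refine sum_congr rfl fun u _ => ?_
    by_cases h : H.Adj u v
    · rw [if_pos h, if_pos h.symm]
    · rw [if_neg h, if_neg fun h' => h h'.symm]
  rw [h1, h1, sum_comm]
  refine sum_congr rfl fun y _ => sum_congr rfl fun x _ => ?_
  by_cases h : H.Adj y x
  · rw [if_pos h, if_pos h.symm]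
  · rw [if_neg h, if_neg fun h' => h h'.symm]

end Counting

end Literature.Combinatorics.SimpleGraph.AlonHooryLinial
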